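import Mathlib
import Literature.LinearAlgebra.Matrix.MaximalVolumeErrorBounds
import Literature.LinearAlgebra.Matrix.EckartYoungMirsky
import Literature.LinearAlgebra.Matrix.RankMinors

/-!
# Maximal-volume cross interpolation: the singular-value bound `‖A - Ã‖_C ≤ (k+1) σ_{k+1}(A)`

The theorem of Goreinov–Tyrtyshnikov [GoreinovTyrtyshnikov2001, Thm 2.1]: if the `k × k` pivot
block `P = A[r, c]` of a real `m × n` matrix `A` is nonsingular and has maximal volume `|det P|`
among all `k × k` submatrices of `A`, then the cross (skeleton, CUR) interpolation
`Ã = A[:, c] P⁻¹ A[r, :]` (`Literature.LinearAlgebra.Matrix.crossInterp A r c`) satisfies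
`‖A - Ã‖_C ≤ (k+1) σ_{k+1}(A)` in the Chebyshev (max-entry) norm, `σ_{k+1}(A)` the `(k+1)`-st
largest singular value; with the relaxed hypothesis `ν |det A[r', c']| ≤ |det P|` for all
`k × k` submatrices (`0 < ν ≤ 1`) the bound is `ν⁻¹ (k+1) σ_{k+1}(A)`
[GoreinovTyrtyshnikov2001, Thm 2.2].  Restated as [AllenLaiShen2024, §1 Thm 1] and the display
before [AllenLaiShen2024, §2 Thm 4], as [DehoogHegland2023, §1 Thm 1], and as the first line of
[Savostyanov2014, §2 eq. (6)].

INDEXING.  Singular values are Mathlib's `LinearMap.singularValues` of `Matrix.toEuclideanLin A`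
(file `Literature.LinearAlgebra.Matrix.EckartYoungMirsky`), which are ZERO-INDEXED and
antitone: `(Matrix.toEuclideanLin A).singularValues k` is the papers' `σ_{k+1}(A)`.  So the
printed `(k+1) σ_{k+1}(A)` reads `(k + 1) * (Matrix.toEuclideanLin A).singularValues k` below.

The determinant half of the proof is `Literature.LinearAlgebra.Matrix.MaximalVolumeErrorBounds`
(`det Â = det P · (A - Ã) i j` for the bordered block `Â = A[(i, r), (j, c)]`, and
`ν |Â⁻¹ p q| |(A - Ã) i j| ≤ 1`, i.e. `‖Â⁻¹‖_C ≤ ν⁻¹ |γ|⁻¹`); this file supplies the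
singular-value half that docstring lists as NOT formalised:

* `norm_le_card_mul_mul_norm_toEuclideanLin_of_forall_norm_inv_le`,
  `inv_card_mul_le_singularValues_of_forall_norm_inv_le` — for a nonsingular `M` with
  `|M⁻¹ p q| ≤ δ` entrywise, `‖x‖ ≤ |o| δ ‖M x‖`, hence `σ_min(M) ≥ (|o| δ)⁻¹`: the chain
  `1 ≤ σ_{r+1}(Ê) ‖Ê⁻¹‖₂ ≤ σ_{r+1}(Ê) (r+1) ‖Ê⁻¹‖_C` of [AllenLaiShen2024, §3 (proof of Thm 1)],
  `σ_{k+1}(Â)⁻¹ ≤ (k+1) ‖Â⁻¹‖_C` in [GoreinovTyrtyshnikov2001, Thm 2.1 (proof)] (with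
  `‖·‖₂ ≤ √(|o||o|) ‖·‖_C`, [GolubVanLoan2013, §2.3.2 (2.3.8)], in place of the Frobenius norm);
* `mul_abs_sub_crossInterp_le_mul_singularValues_submatrix` — `ν |(A - Ã) i j| ≤ (k+1) σ_{k+1}(Â)`
  for the bordered `(k+1) × (k+1)` block;
* `abs_sub_crossInterp_le_mul_singularValues_of_volume_submaximal_fin` (`ν`-relaxed,
  [GoreinovTyrtyshnikov2001, Thm 2.2]) and
  `abs_sub_crossInterp_le_mul_singularValues_of_volume_maximal_fin`
  ([GoreinovTyrtyshnikov2001, Thm 2.1]) — the interlacing step `σ_{k+1}(Â) ≤ σ_{k+1}(A)`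
  (`Literature.LinearAlgebra.Matrix.singularValues_submatrix_le`); the versions
  `abs_sub_crossInterp_le_mul_singularValues_of_volume_submaximal` /
  `abs_sub_crossInterp_le_mul_singularValues_of_volume_maximal` for pivots indexed by any finite
  type `ι` (`k = |ι|`);
* `exists_isUnit_det_forall_abs_det_le` — a maximal-volume `k × k` block exists and is nonsingular
  whenever `k ≤ rank A` [AllenLaiShen2024, §2 (after Thm 3)];
  `exists_abs_sub_crossInterp_le_mul_singularValues` — hence for `k ≤ rank A` some `k` rows and
  `k` columns give `‖A - Ã‖_C ≤ (k+1) σ_{k+1}(A)`;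
  `exists_le_abs_sub_crossInterp_le_mul_singularValues` — for every `k`, some `s ≤ k` pivots do
  (with `s = rank A` the interpolation is exact);
* `norm_toEuclideanLin_sub_crossInterp_le_of_volume_maximal_fin` — the spectral-norm consequence
  `‖(A - Ã) x‖ ≤ √(|m||n|) (k+1) σ_{k+1}(A) ‖x‖` via [GolubVanLoan2013, §2.3.2 (2.3.8)].

Scalars are real (the maximal-volume hypothesis of `MaximalVolumeErrorBounds` is stated with the
order of the field).  NOT formalised: the sharpenings of [AllenLaiShen2024, Thm 3, Thm 4]
(factor `(r+1)/√(1 + r σ²_{r+1}(A) / ((r+1) ‖A‖₂²))`) and of [DehoogHegland2023, Thm 3, Thm 4]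
(harmonic means of the singular values), which need the Frobenius identity `‖M‖_F² = Σ σ_i(M)²`;
the `r^{r/2}`-comparison of dominant and maximal-volume blocks; the complex case.

References: S. A. Goreinov, E. E. Tyrtyshnikov, *The maximal-volume concept in approximation by
low-rank matrices*, Contemp. Math. 280 (2001) 47–51, Thm 2.1, Thm 2.2; K. Allen, M.-J. Lai,
Z. Shen, *Maximal volume matrix cross approximation for image compression and least squares
solution*, Adv. Comput. Math. (2024), arXiv:2309.17403, §1 Thm 1, §2, §3; F. de Hoog, M. Hegland,
*A note on error bounds for pseudo skeleton approximations of matrices*, Linear Algebra Appl. 669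
(2023) 102–117, arXiv:2107.01819, §1 Thm 1; D. V. Savostyanov, *Quasioptimality of maximum-volume
cross interpolation of tensors*, Linear Algebra Appl. 458 (2014) 217–244, §2 eq. (6);
G. H. Golub, C. F. Van Loan, *Matrix Computations*, 4th ed. (2013), §2.3.2 (2.3.8).
AI-produced formalisation (H21 engines group, seat eng-quad-2, 2026-08-22); no facts, no axioms
beyond Mathlib's, no `sorry`.
-/

noncomputable section

open Matrix Module

namespace Literature.LinearAlgebra.Matrix

/-! ## The smallest singular value of a nonsingular matrix is controlled by its inverse -/

section InverseBound

variable {𝕜 : Type*} [RCLike 𝕜] {o : Type*} [Fintype o] [DecidableEq o]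

/-- [cite: AllenLaiShen2024, §3 (proof of Thm 1)]; [cite: GolubVanLoan2013, §2.3.2 (2.3.8)]
A NONSINGULAR MATRIX WITH SMALL INVERSE ENTRIES CANNOT SHRINK VECTORS MUCH: if `M` is nonsingular
and `‖M⁻¹ p q‖ ≤ δ` for all `p, q`, then `‖x‖ ≤ |o| · δ · ‖M x‖` for every `x` — from
`x = M⁻¹ (M x)` and `‖M⁻¹‖₂ ≤ √(|o|·|o|) ‖M⁻¹‖_C = |o| δ`; the step
`‖Ê⁻¹‖₂ ≤ ‖Ê⁻¹‖_F ≤ (r+1) ‖Ê⁻¹‖_C` of [AllenLaiShen2024, §3]. -/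
theorem norm_le_card_mul_mul_norm_toEuclideanLin_of_forall_norm_inv_le (M : Matrix o o 𝕜)
    (hM : IsUnit M.det) {δ : ℝ} (hδ : 0 ≤ δ) (hinv : ∀ p q, ‖M⁻¹ p q‖ ≤ δ)
    (x : EuclideanSpace 𝕜 o) :
    ‖x‖ ≤ Fintype.card o * δ * ‖Matrix.toEuclideanLin M x‖ := by
  have hx : Matrix.toEuclideanLin M⁻¹ (Matrix.toEuclideanLin M x) = x := by
    rw [← LinearMap.comp_apply, ← Matrix.toLpLin_mul_same, Matrix.nonsing_inv_mul _ hM,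
      Matrix.toLpLin_one, LinearMap.id_apply]
  have h := norm_toEuclideanLin_le_of_forall_norm_entry_le M⁻¹ hδ hinv (Matrix.toEuclideanLin M x)
  rw [hx, Real.sqrt_mul_self (Nat.cast_nonneg _)] at h
  exact h

/-- [cite: GoreinovTyrtyshnikov2001, Thm 2.1 (proof)]; [cite: AllenLaiShen2024, §3 (proof of Thm 1)]
THE SMALLEST SINGULAR VALUE FROM THE INVERSE: if `M` (`|o| ≥ 1`) is nonsingular with
`‖M⁻¹ p q‖ ≤ δ` for all `p, q` (`0 < δ`), then `(|o| δ)⁻¹ ≤ σ_min(M) = σ_{|o|-1}(M)` (zero-indexed)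
— the inequality `1 ≤ σ_{r+1}(Ê) ‖Ê⁻¹‖₂ ≤ σ_{r+1}(Ê) (r+1) ‖Ê⁻¹‖_C` of [AllenLaiShen2024, §3],
`σ_{k+1}(Â)⁻¹ ≤ (k+1) ‖Â⁻¹‖_C` in [GoreinovTyrtyshnikov2001, Thm 2.1 (proof)]; by the max–min
characterisation `Literature.LinearAlgebra.Matrix.le_singularValues_of_forall_mem_le_norm_apply`
on the whole space. -/
theorem inv_card_mul_le_singularValues_of_forall_norm_inv_le [Nonempty o] (M : Matrix o o 𝕜)
    (hM : IsUnit M.det) {δ : ℝ} (hδ : 0 < δ) (hinv : ∀ p q, ‖M⁻¹ p q‖ ≤ δ) :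
    (Fintype.card o * δ)⁻¹ ≤ (Matrix.toEuclideanLin M).singularValues (Fintype.card o - 1) := by
  have hcard : 0 < Fintype.card o := Fintype.card_pos
  have hpos : (0 : ℝ) < Fintype.card o * δ := mul_pos (Nat.cast_pos.mpr hcard) hδ
  refine le_singularValues_of_forall_mem_le_norm_apply (Matrix.toEuclideanLin M)
    finrank_euclideanSpace (Fintype.card o - 1) ⊤ ?_ fun x _ => ?_
  · rw [finrank_top, finrank_euclideanSpace]; omega
  · rw [inv_mul_le_iff₀ hpos]
    exact norm_le_card_mul_mul_norm_toEuclideanLin_of_forall_norm_inv_le M hM hδ.le hinv x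

end InverseBound

/-! ## Nonsingular blocks have injective index maps -/

section Injective

variable {K : Type*} [CommRing K] {m n ι : Type*} [Fintype ι] [DecidableEq ι]

/-- [folklore] A submatrix with a repeated row index has two equal rows, so a nonsingular
`A[r, c]` has injective `r`. -/
private theorem injective_left_of_det_submatrix_ne_zero (A : Matrix m n K) {r : ι → m} {c : ι → n}
    (h : (A.submatrix r c).det ≠ 0) : Function.Injective r := by
  intro p q hpq
  by_contra hne
  exact h (Matrix.det_zero_of_row_eq hne (funext fun s => by simp [Matrix.submatrix_apply, hpq]))

/-- [folklore] A submatrix with a repeated column index has two equal columns, so a nonsingular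
`A[r, c]` has injective `c`. -/
private theorem injective_right_of_det_submatrix_ne_zero (A : Matrix m n K) {r : ι → m}
    {c : ι → n} (h : (A.submatrix r c).det ≠ 0) : Function.Injective c := by
  intro p q hpq
  by_contra hne
  exact h (Matrix.det_zero_of_column_eq hne fun s => by simp [Matrix.submatrix_apply, hpq])

end Injective

/-! ## Goreinov–Tyrtyshnikov, Theorems 2.1 and 2.2 -/

section MaximalVolume

variable {m n : Type*} [Fintype m] [Fintype n] [DecidableEq n] {k : ℕ}

omit [Fintype m] [Fintype n] [DecidableEq n] in
/-- [cite: GoreinovTyrtyshnikov2001, Thm 2.1 (proof)]; [cite: GoreinovTyrtyshnikov2001, Thm 2.2];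
[cite: AllenLaiShen2024, §3 (proof of Thm 1)]
THE ERROR ENTRY AGAINST THE BORDERED BLOCK: if `P = A[r, c]` is a nonsingular `k × k` block with
`ν |det A[r', c']| ≤ |det P|` for every `k × k` submatrix of `A` (`0 < ν`; `ν = 1` is maximal
volume), then for every `i, j` the error `γ = (A - Ã) i j` of the cross interpolation
`Ã = A[:, c] P⁻¹ A[r, :]` satisfies `ν |γ| ≤ (k+1) σ_{k+1}(Â)`, `Â = A[(i, r), (j, c)]` the
`(k+1) × (k+1)` bordered block (zero-indexed: `singularValues k`).  Proof: `γ = 0` is trivial;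
otherwise `Â` is nonsingular (`det Â = det P · γ`), `‖Â⁻¹‖_C ≤ (ν |γ|)⁻¹`
(`mul_abs_inv_submatrix_vecCons_vecCons_mul_abs_le_one`) and `σ_min(Â) ≥ ((k+1) ‖Â⁻¹‖_C)⁻¹`. -/
theorem mul_abs_sub_crossInterp_le_mul_singularValues_submatrix (A : Matrix m n ℝ)
    (r : Fin k → m) (c : Fin k → n) (hP : IsUnit (A.submatrix r c).det) {ν : ℝ} (hν : 0 < ν)
    (hmax : ∀ (r' : Fin k → m) (c' : Fin k → n),
      ν * |(A.submatrix r' c').det| ≤ |(A.submatrix r c).det|)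
    (i : m) (j : n) :
    ν * |(A - crossInterp A r c) i j| ≤
      (k + 1) *
        (Matrix.toEuclideanLin (A.submatrix (vecCons i r) (vecCons j c))).singularValues k := by
  by_cases hγ : (A - crossInterp A r c) i j = 0
  · rw [hγ, abs_zero, mul_zero]
    exact mul_nonneg (by positivity) (LinearMap.singularValues_nonneg _ _)
  have hB : IsUnit (A.submatrix (vecCons i r) (vecCons j c)).det := by
    rw [det_submatrix_vecCons_vecCons A r c hP i j]; exact hP.mul (Ne.isUnit hγ)
  have hνγ : 0 < ν * |(A - crossInterp A r c) i j| := mul_pos hν (abs_pos.mpr hγ)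
  have hinv : ∀ p q, ‖(A.submatrix (vecCons i r) (vecCons j c))⁻¹ p q‖ ≤
      (ν * |(A - crossInterp A r c) i j|)⁻¹ := fun p q => by
    rw [Real.norm_eq_abs]
    have key := mul_abs_inv_submatrix_vecCons_vecCons_mul_abs_le_one A r c hP hmax i j p q
    calc |(A.submatrix (vecCons i r) (vecCons j c))⁻¹ p q|
        = ν * |(A.submatrix (vecCons i r) (vecCons j c))⁻¹ p q| * |(A - crossInterp A r c) i j| *
            (ν * |(A - crossInterp A r c) i j|)⁻¹ := by
          rw [eq_comm, mul_inv_eq_iff_eq_mul₀ hνγ.ne']; ring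
      _ ≤ 1 * (ν * |(A - crossInterp A r c) i j|)⁻¹ :=
          mul_le_mul_of_nonneg_right key (inv_nonneg.mpr hνγ.le)
      _ = (ν * |(A - crossInterp A r c) i j|)⁻¹ := one_mul _
  have hσ := inv_card_mul_le_singularValues_of_forall_norm_inv_le
    (A.submatrix (vecCons i r) (vecCons j c)) hB (inv_pos.mpr hνγ) hinv
  simp only [Fintype.card_fin, Nat.succ_sub_one, Nat.cast_succ, mul_inv, inv_inv] at hσ
  have hk : (0 : ℝ) < (k : ℝ) + 1 := by positivity
  rwa [inv_mul_le_iff₀ hk] at hσ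

/-- [cite: GoreinovTyrtyshnikov2001, Thm 2.2]; [cite: AllenLaiShen2024, §2 (display before Thm 4)]
GOREINOV–TYRTYSHNIKOV WITH A VOLUME RELAXATION FACTOR, pivots as `Fin k`-lists: if `P = A[r, c]`
is nonsingular and `ν |det A[r', c']| ≤ |det P|` for every `k × k` submatrix `A[r', c']` of `A`
(`0 < ν`), then `|(A - Ã) i j| ≤ ν⁻¹ (k+1) σ_{k+1}(A)` for all `i, j`
(`Ã = crossInterp A r c`; zero-indexed `singularValues k`).  From the bordered-block bound and
the interlacing `σ_{k+1}(Â) ≤ σ_{k+1}(A)` (`singularValues_submatrix_le`; the bordered block is a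
genuine submatrix because `det Â ≠ 0` forces distinct row and column indices). -/
theorem abs_sub_crossInterp_le_mul_singularValues_of_volume_submaximal_fin (A : Matrix m n ℝ)
    (r : Fin k → m) (c : Fin k → n) (hP : IsUnit (A.submatrix r c).det) {ν : ℝ} (hν : 0 < ν)
    (hmax : ∀ (r' : Fin k → m) (c' : Fin k → n),
      ν * |(A.submatrix r' c').det| ≤ |(A.submatrix r c).det|)
    (i : m) (j : n) :
    |(A - crossInterp A r c) i j| ≤
      ν⁻¹ * ((k + 1) * (Matrix.toEuclideanLin A).singularValues k) := by
  rw [← div_eq_inv_mul, le_div_iff₀ hν]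
  by_cases hγ : (A - crossInterp A r c) i j = 0
  · rw [hγ, abs_zero, zero_mul]
    exact mul_nonneg (by positivity) (LinearMap.singularValues_nonneg _ _)
  have hB : (A.submatrix (vecCons i r) (vecCons j c)).det ≠ 0 := by
    rw [det_submatrix_vecCons_vecCons A r c hP i j]; exact mul_ne_zero hP.ne_zero hγ
  calc |(A - crossInterp A r c) i j| * ν = ν * |(A - crossInterp A r c) i j| := mul_comm _ _
    _ ≤ (k + 1) *
        (Matrix.toEuclideanLin (A.submatrix (vecCons i r) (vecCons j c))).singularValues k :=
      mul_abs_sub_crossInterp_le_mul_singularValues_submatrix A r c hP hν hmax i j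
    _ ≤ (k + 1) * (Matrix.toEuclideanLin A).singularValues k :=
      mul_le_mul_of_nonneg_left (singularValues_submatrix_le A
        (injective_left_of_det_submatrix_ne_zero A hB)
        (injective_right_of_det_submatrix_ne_zero A hB) k) (by positivity)

/-- [cite: GoreinovTyrtyshnikov2001, Thm 2.1]; [cite: AllenLaiShen2024, §1 Thm 1];
[cite: DehoogHegland2023, §1 Thm 1]; [cite: Savostyanov2014, §2 eq. (6)]
THE MAXIMAL-VOLUME PRINCIPLE (Goreinov–Tyrtyshnikov), pivots as `Fin k`-lists: if the `k × k`
pivot block `P = A[r, c]` is nonsingular and `|det A[r', c']| ≤ |det P|` for every `k × k`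
submatrix of `A`, then the cross interpolation `Ã = A[:, c] P⁻¹ A[r, :]` satisfies
`‖A - Ã‖_C ≤ (k+1) σ_{k+1}(A)`, entrywise `|(A - Ã) i j| ≤ (k+1) σ_{k+1}(A)` (zero-indexed
`singularValues k`). -/
theorem abs_sub_crossInterp_le_mul_singularValues_of_volume_maximal_fin (A : Matrix m n ℝ)
    (r : Fin k → m) (c : Fin k → n) (hP : IsUnit (A.submatrix r c).det)
    (hmax : ∀ (r' : Fin k → m) (c' : Fin k → n),
      |(A.submatrix r' c').det| ≤ |(A.submatrix r c).det|)
    (i : m) (j : n) :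
    |(A - crossInterp A r c) i j| ≤ (k + 1) * (Matrix.toEuclideanLin A).singularValues k := by
  have h := abs_sub_crossInterp_le_mul_singularValues_of_volume_submaximal_fin A r c hP one_pos
    (fun r' c' => by rw [one_mul]; exact hmax r' c') i j
  rwa [inv_one, one_mul] at h

/-- [cite: GoreinovTyrtyshnikov2001, Thm 2.2]; [cite: AllenLaiShen2024, §2 (display before Thm 4)]
Goreinov–Tyrtyshnikov with the relaxation factor `ν`, pivots indexed by an arbitrary finite type
`ι` (`k = |ι|`): `ν |det A[r', c']| ≤ |det P|` for all `r' : ι → m`, `c' : ι → n` and `P`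
nonsingular give `|(A - Ã) i j| ≤ ν⁻¹ (|ι|+1) σ_{|ι|+1}(A)` (zero-indexed `singularValues |ι|`). -/
theorem abs_sub_crossInterp_le_mul_singularValues_of_volume_submaximal {ι : Type*} [Fintype ι]
    [DecidableEq ι] (A : Matrix m n ℝ) (r : ι → m) (c : ι → n)
    (hP : IsUnit (A.submatrix r c).det) {ν : ℝ} (hν : 0 < ν)
    (hmax : ∀ (r' : ι → m) (c' : ι → n), ν * |(A.submatrix r' c').det| ≤ |(A.submatrix r c).det|)
    (i : m) (j : n) :
    |(A - crossInterp A r c) i j| ≤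
      ν⁻¹ * ((Fintype.card ι + 1) * (Matrix.toEuclideanLin A).singularValues (Fintype.card ι)) := by
  set e : Fin (Fintype.card ι) ≃ ι := (Fintype.equivFin ι).symm with he
  have hsub : ∀ (r' : ι → m) (c' : ι → n),
      (A.submatrix (r' ∘ e) (c' ∘ e)).det = (A.submatrix r' c').det := fun r' c' => by
    rw [show A.submatrix (r' ∘ ⇑e) (c' ∘ ⇑e) = (A.submatrix r' c').submatrix e e from rfl,
      det_submatrix_equiv_self]
  have hP' : IsUnit (A.submatrix (r ∘ e) (c ∘ e)).det := by rwa [hsub]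
  have hmax' : ∀ (r' : Fin (Fintype.card ι) → m) (c' : Fin (Fintype.card ι) → n),
      ν * |(A.submatrix r' c').det| ≤ |(A.submatrix (r ∘ e) (c ∘ e)).det| := fun r' c' => by
    rw [hsub r c]
    have h2 := hmax (r' ∘ e.symm) (c' ∘ e.symm)
    rw [← hsub] at h2
    simpa only [Function.comp_assoc, Equiv.symm_comp_self, Function.comp_id] using h2
  have h := abs_sub_crossInterp_le_mul_singularValues_of_volume_submaximal_fin A (r ∘ e) (c ∘ e)
    hP' hν hmax' i j
  rwa [crossInterp_comp_equiv] at h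

/-- [cite: GoreinovTyrtyshnikov2001, Thm 2.1]; [cite: AllenLaiShen2024, §1 Thm 1];
[cite: DehoogHegland2023, §1 Thm 1]; [cite: Savostyanov2014, §2 eq. (6)]
THE MAXIMAL-VOLUME PRINCIPLE, pivots indexed by an arbitrary finite type `ι` (`k = |ι|`): if
`P = A[r, c]` is nonsingular of maximal volume among the `|ι| × |ι|` submatrices of `A`, then
`|(A - Ã) i j| ≤ (|ι|+1) σ_{|ι|+1}(A)` for all `i, j` (zero-indexed `singularValues |ι|`). -/
theorem abs_sub_crossInterp_le_mul_singularValues_of_volume_maximal {ι : Type*} [Fintype ι]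
    [DecidableEq ι] (A : Matrix m n ℝ) (r : ι → m) (c : ι → n)
    (hP : IsUnit (A.submatrix r c).det)
    (hmax : ∀ (r' : ι → m) (c' : ι → n), |(A.submatrix r' c').det| ≤ |(A.submatrix r c).det|)
    (i : m) (j : n) :
    |(A - crossInterp A r c) i j| ≤
      (Fintype.card ι + 1) * (Matrix.toEuclideanLin A).singularValues (Fintype.card ι) := by
  have h := abs_sub_crossInterp_le_mul_singularValues_of_volume_submaximal A r c hP one_pos
    (fun r' c' => by rw [one_mul]; exact hmax r' c') i j
  rwa [inv_one, one_mul] at h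

/-! ## Existence of maximal-volume blocks and the unconditional form -/

omit [DecidableEq n] in
/-- [cite: AllenLaiShen2024, §2 (after Thm 3)]; [cite: GoreinovTyrtyshnikov2001, Thm 2.1]
A MAXIMAL-VOLUME `k × k` BLOCK EXISTS AND IS NONSINGULAR whenever `k ≤ rank A`: there are
finitely many `k × k` submatrices, and one of them has a nonzero determinant
(`exists_det_submatrix_ne_zero_of_le_rank`). -/
theorem exists_isUnit_det_forall_abs_det_le {K : Type*} [Field K] [LinearOrder K]
    [IsStrictOrderedRing K] (A : Matrix m n K) (hk : k ≤ A.rank) :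
    ∃ (r : Fin k → m) (c : Fin k → n), IsUnit (A.submatrix r c).det ∧
      ∀ (r' : Fin k → m) (c' : Fin k → n), |(A.submatrix r' c').det| ≤ |(A.submatrix r c).det| := by
  classical
  obtain ⟨r₀, c₀, -, -, h₀⟩ := exists_det_submatrix_ne_zero_of_le_rank A hk
  haveI : Nonempty ((Fin k → m) × (Fin k → n)) := ⟨(r₀, c₀)⟩
  obtain ⟨p, hp⟩ := Finite.exists_max fun p : (Fin k → m) × (Fin k → n) =>
    |(A.submatrix p.1 p.2).det|
  refine ⟨p.1, p.2, ?_, fun r' c' => hp (r', c')⟩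
  exact Ne.isUnit (abs_pos.mp ((abs_pos.mpr h₀).trans_le (hp (r₀, c₀))))

/-- [cite: GoreinovTyrtyshnikov2001, Thm 2.1]; [cite: AllenLaiShen2024, §1 Thm 1];
[cite: DehoogHegland2023, §1 Thm 1]
THE MAXIMAL-VOLUME PRINCIPLE, EXISTENCE FORM: for every `k ≤ rank A` there are `k` rows `r` and
`k` columns `c` with nonsingular pivot block such that `‖A - A[:, c] A[r, c]⁻¹ A[r, :]‖_C ≤
(k+1) σ_{k+1}(A)` (zero-indexed `singularValues k`) — take a block of maximal volume. -/
theorem exists_abs_sub_crossInterp_le_mul_singularValues (A : Matrix m n ℝ) (hk : k ≤ A.rank) :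
    ∃ (r : Fin k → m) (c : Fin k → n), IsUnit (A.submatrix r c).det ∧
      ∀ i j, |(A - crossInterp A r c) i j| ≤
        (k + 1) * (Matrix.toEuclideanLin A).singularValues k := by
  obtain ⟨r, c, hP, hmax⟩ := exists_isUnit_det_forall_abs_det_le A hk
  exact ⟨r, c, hP, abs_sub_crossInterp_le_mul_singularValues_of_volume_maximal_fin A r c hP hmax⟩

/-- [cite: GoreinovTyrtyshnikov2001, Thm 2.1]; [cite: AllenLaiShen2024, §1 Thm 1]
RANK-ADAPTIVE FORM: for EVERY target `k` there are `s ≤ k` pivots with nonsingular pivot block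
whose cross interpolation satisfies `‖A - Ã‖_C ≤ (k+1) σ_{k+1}(A)` (zero-indexed
`singularValues k`): `s = k` if `k ≤ rank A`, else `s = rank A`, in which case `Ã = A`
because `σ_{s+1}(A) = 0` (`singularValues_toEuclideanLin_eq_zero_iff_rank_le`). -/
theorem exists_le_abs_sub_crossInterp_le_mul_singularValues (A : Matrix m n ℝ) (k : ℕ) :
    ∃ (s : ℕ) (r : Fin s → m) (c : Fin s → n), s ≤ k ∧ IsUnit (A.submatrix r c).det ∧
      ∀ i j, |(A - crossInterp A r c) i j| ≤
        (k + 1) * (Matrix.toEuclideanLin A).singularValues k := by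
  rcases le_or_gt k A.rank with hk | hk
  · obtain ⟨r, c, hP, h⟩ := exists_abs_sub_crossInterp_le_mul_singularValues A hk
    exact ⟨k, r, c, le_rfl, hP, h⟩
  · obtain ⟨r, c, hP, h⟩ := exists_abs_sub_crossInterp_le_mul_singularValues A (le_refl A.rank)
    refine ⟨A.rank, r, c, hk.le, hP, fun i j => (h i j).trans ?_⟩
    have h0 : (Matrix.toEuclideanLin A).singularValues A.rank = 0 :=
      (singularValues_toEuclideanLin_eq_zero_iff_rank_le A A.rank).mpr le_rfl
    rw [h0, mul_zero]
    exact mul_nonneg (by positivity) (LinearMap.singularValues_nonneg _ _)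

/-- [cite: GoreinovTyrtyshnikov2001, Thm 2.1]; [cite: GolubVanLoan2013, §2.3.2 (2.3.8)]
THE SPECTRAL-NORM CONSEQUENCE: under maximal volume, `‖(A - Ã) x‖ ≤ √(|m||n|) (k+1) σ_{k+1}(A) ‖x‖`
for every `x`, i.e. `‖A - Ã‖₂ ≤ √(mn) (k+1) σ_{k+1}(A)`, by `‖E‖₂ ≤ √(mn) ‖E‖_C`
(`norm_toEuclideanLin_le_of_forall_norm_entry_le`). -/
theorem norm_toEuclideanLin_sub_crossInterp_le_of_volume_maximal_fin (A : Matrix m n ℝ)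
    (r : Fin k → m) (c : Fin k → n) (hP : IsUnit (A.submatrix r c).det)
    (hmax : ∀ (r' : Fin k → m) (c' : Fin k → n),
      |(A.submatrix r' c').det| ≤ |(A.submatrix r c).det|)
    (x : EuclideanSpace ℝ n) :
    ‖Matrix.toEuclideanLin (A - crossInterp A r c) x‖ ≤
      √(Fintype.card m * Fintype.card n) * ((k + 1) * (Matrix.toEuclideanLin A).singularValues k) *
        ‖x‖ :=
  norm_toEuclideanLin_le_of_forall_norm_entry_le _
    (mul_nonneg (by positivity) (LinearMap.singularValues_nonneg _ _))
    (fun i j => by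
      rw [Real.norm_eq_abs]
      exact abs_sub_crossInterp_le_mul_singularValues_of_volume_maximal_fin A r c hP hmax i j) x

end MaximalVolume

end Literature.LinearAlgebra.Matrix
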